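import Literature.NumberTheory.PAdicHodge.AinfRamifiedTorsionLift
import Literature.NumberTheory.EllipticCurves.FormalGroupEndomorphismsUniversalProofs
import HarnessLib

/-!
# Fontaine's element is additive over the ramified base: `[t ⊕ t'] = [t] ⊕_W [t']` in `Ŵ(𝔫_𝒪) ⊂ A_inf(𝒪) = 𝔸_inf(F)[ϖ]`

Topic `Literature/NumberTheory/PAdicHodge`; the ramified twin of `AinfWeierstrassTorsionLiftAdd` (case `𝒪 = ℤ_p`, `W/ℤ`) —
verbatim transcription along the dictionary `(𝔸_inf, (p, ξ), AinfTop F p, W/ℤ) ↦ (A_inf(𝒪), (p, ω), AinfRamTop D, W/𝒪_D)`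
of seat bsd-line-edix-p4 g12's memo `Cruxes/StarredOptimalManinUnitFiveSeven/Lines/kato-lever-hDR-R1-ring.md`. AEC IV.2.3
`[n](F(z₁,z₂)) = F([n]z₁,[n]z₂)` over EVERY commutative ring is the tree theorem `WeierstrassCurve.formalMul_subst_formalGroupLaw'`
(`EllipticCurves/FormalGroupEndomorphismsUniversalProofs`), so no hypothesis on `𝒪_D` is needed. For a Weierstrass equation `W`
over `𝒪_D = ℤ_p[X]/(f)` (`EisensteinRoot.CoeffDisc D`):

* `addW`, `addWC` — the formal group law `⊕_W` on `Ŵ(𝔫_𝒪)` and on `Ŵ(𝔪_{ℂ_F})`; `mulP_addW : [p](a ⊕ b) = [p]a ⊕ [p]b`,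
  `mulPC_addWC`, `theta_addW`, congruence-continuity `addW_sub_addW_mem`;
* **`torsionLift_addSeq : [t ⊕ t'] = [t] ⊕_W [t']`** for `[p]`-compatible torsion sequences `t, t'` of `Ŵ(𝔪_{ℂ_F})`.

Definitions (reviewed): `addW`, `addWC`, `addSeq` (as in the unramified file). No named facts, no `sorry`. BSD route
EdixhovenFibreFiveSeven, crux K★ `stmt-BirchSwinnertonDyer-22226`, road (R1): input of the additivity of the ω- and η-period maps
on `T_pŴ(𝒪_{ℂ_F})` over the ramified base. Nothing about elliptic curves over number fields is proved here.

## References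
* J. H. Silverman, *The Arithmetic of Elliptic Curves* (2009), IV.2.3. [SilvermanAEC2009]
* J.-M. Fontaine, *Le corps des périodes p-adiques*, Astérisque 223 (1994), Exp. II §1.2. [FontaineAsterisque223III]
* J.-P. Serre, *Local class field theory* (Cassels–Fröhlich Ch. VI) §3.2. [CasselsFrohlichANT1967]
-/

noncomputable section

open Ideal Field WittVector MvPowerSeries ValuativeRel

namespace Literature.NumberTheory.PAdicHodge

open Literature.NumberTheory.GaloisRepresentations
open Literature.NumberTheory.GaloisRepresentations.IsNonarchimedeanLocalField
open Literature.NumberTheory.GaloisRepresentations.LubinTate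

namespace AinfRamTop

variable {F : Type} [Field F] [ValuativeRel F] [TopologicalSpace F] [IsNonarchimedeanLocalField F] [CharZero F]
  {p : ℕ} [Fact p.Prime] [Fact (¬ IsUnit (p : integerC F))] [IsAdicComplete (Ideal.span {(p : integerC F)}) (integerC F)]
  {hp : valuation F p < 1} {D : EisensteinRoot F p hp}
  {hθ : Function.Surjective (fontaineTheta (integerC F) p)}
  (W : WeierstrassCurve (EisensteinRoot.CoeffDisc D))

/-! ## §2 The formal group law on `Ŵ(𝔫)` and `Ŵ(𝔪_{ℂ_F})` -/

/-- **`a ⊕_W b`** on `Ŵ(𝔫)`: the integral chord–tangent law of `W` evaluated at points of `𝔫_𝒪 ⊂ A_inf(𝒪)`.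
[cite: CasselsFrohlichANT1967, Ch. VI §3.2] -/
def addW (a b : (nilTheta D hθ).toIdeal) : (nilTheta D hθ).toIdeal :=
  evalPt (nilTheta D hθ) W.formalGroupLaw W.constantCoeff_formalGroupLaw ![a, b]

/-- **`s ⊕_W s'`** on `Ŵ(𝔪_{ℂ_F})`. [cite: CasselsFrohlichANT1967, Ch. VI §3.2] -/
def addWC (s s' : (maxNilIdealC F).toIdeal) : (maxNilIdealC F).toIdeal :=
  evalPt (maxNilIdealC F) W.formalGroupLaw W.constantCoeff_formalGroupLaw ![s, s']

omit [Fact (¬ IsUnit (p : integerC F))] [IsAdicComplete (Ideal.span {(p : integerC F)}) (integerC F)] in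
/-- The substituted family `([p]z₁, [p]z₂)` has no constant terms. [cite: SilvermanAEC2009, IV.2.3] -/
private theorem constantCoeff_formalMul_subst_X_fin (i : Fin 2) :
    MvPowerSeries.constantCoeff ((W.formalMul p).subst (MvPowerSeries.X i : MvPowerSeries (Fin 2) (EisensteinRoot.CoeffDisc D))) = 0 :=
  MvPowerSeries.constantCoeff_subst_eq_zero (PowerSeries.HasSubst.const (PowerSeries.HasSubst.X i))
    (fun _ => MvPowerSeries.constantCoeff_X i) (W.constantCoeff_formalMul p)

omit [Fact (¬ IsUnit (p : integerC F))] [IsAdicComplete (Ideal.span {(p : integerC F)}) (integerC F)] in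
/-- `F([p]z₁, [p]z₂)` has no constant term. [cite: SilvermanAEC2009, IV.2.3] -/
private theorem constantCoeff_formalGroupLaw_subst_formalMul :
    MvPowerSeries.constantCoeff (MvPowerSeries.subst ![(W.formalMul p).subst (MvPowerSeries.X 0 : MvPowerSeries (Fin 2) (EisensteinRoot.CoeffDisc D)),
        (W.formalMul p).subst (MvPowerSeries.X 1 : MvPowerSeries (Fin 2) (EisensteinRoot.CoeffDisc D))] W.formalGroupLaw) = 0 :=
  constantCoeff_subst_zero (fun i => by fin_cases i <;> exact constantCoeff_formalMul_subst_X_fin W _)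
    W.constantCoeff_formalGroupLaw

omit [Fact (¬ IsUnit (p : integerC F))] [IsAdicComplete (Ideal.span {(p : integerC F)}) (integerC F)] in
/-- `[p](F(z₁,z₂))` has no constant term. [cite: SilvermanAEC2009, IV.2.3] -/
private theorem constantCoeff_formalMul_subst_formalGroupLaw :
    MvPowerSeries.constantCoeff ((W.formalMul p).subst W.formalGroupLaw) = 0 :=
  constantCoeff_subst_zero (σ := Unit) (fun _ => W.constantCoeff_formalGroupLaw) (W.constantCoeff_formalMul p)

omit [Fact (¬ IsUnit (p : integerC F))] [IsAdicComplete (Ideal.span {(p : integerC F)}) (integerC F)] in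
/-- **`[p](G(a, b)) = F([p]a, [p]b)` on points of any nil ideal** (AEC IV.2.3 transported by evaluation).
[cite: CasselsFrohlichANT1967, Ch. VI §3.2] -/
private theorem evalPt₁_formalMul_evalPt {S : Type*} [CommRing S] [UniformSpace S] [IsUniformAddGroup S] [IsTopologicalRing S]
    [IsLinearTopology S S] [T2Space S] [CompleteSpace S] [Algebra (EisensteinRoot.CoeffDisc D) S] [ContinuousSMul (EisensteinRoot.CoeffDisc D) S] (M : NilIdeal S)
    (x : Fin 2 → M.toIdeal) :
    evalPt₁ M (W.formalMul p) (W.constantCoeff_formalMul p) (evalPt M W.formalGroupLaw W.constantCoeff_formalGroupLaw x) =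
      evalPt M W.formalGroupLaw W.constantCoeff_formalGroupLaw
        ![evalPt₁ M (W.formalMul p) (W.constantCoeff_formalMul p) (x 0), evalPt₁ M (W.formalMul p) (W.constantCoeff_formalMul p) (x 1)] := by
  rw [← evalPt₁_subst M W.formalGroupLaw W.constantCoeff_formalGroupLaw (W.formalMul p) (W.constantCoeff_formalMul p)
      (constantCoeff_formalMul_subst_formalGroupLaw W) x,
    evalPt_congr M (W.formalMul_subst_formalGroupLaw' p) (constantCoeff_formalMul_subst_formalGroupLaw W)
      (constantCoeff_formalGroupLaw_subst_formalMul W) x,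
    evalPt_subst M (a := ![(W.formalMul p).subst (MvPowerSeries.X 0 : MvPowerSeries (Fin 2) (EisensteinRoot.CoeffDisc D)),
        (W.formalMul p).subst (MvPowerSeries.X 1 : MvPowerSeries (Fin 2) (EisensteinRoot.CoeffDisc D))])
      (fun i => by fin_cases i <;> exact constantCoeff_formalMul_subst_X_fin W _) W.formalGroupLaw
      W.constantCoeff_formalGroupLaw (constantCoeff_formalGroupLaw_subst_formalMul W) x]
  congr 1
  funext i
  fin_cases i
  · show evalPt M ((W.formalMul p).subst (MvPowerSeries.X 0 : MvPowerSeries (Fin 2) (EisensteinRoot.CoeffDisc D))) _ x = _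
    rw [evalPt₁_subst M (MvPowerSeries.X 0 : MvPowerSeries (Fin 2) (EisensteinRoot.CoeffDisc D)) (MvPowerSeries.constantCoeff_X 0)
      (W.formalMul p) (W.constantCoeff_formalMul p), evalPt_X]
    rfl
  · show evalPt M ((W.formalMul p).subst (MvPowerSeries.X 1 : MvPowerSeries (Fin 2) (EisensteinRoot.CoeffDisc D))) _ x = _
    rw [evalPt₁_subst M (MvPowerSeries.X 1 : MvPowerSeries (Fin 2) (EisensteinRoot.CoeffDisc D)) (MvPowerSeries.constantCoeff_X 1)
      (W.formalMul p) (W.constantCoeff_formalMul p), evalPt_X]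
    rfl

/-- **`[p](a ⊕ b) = [p]a ⊕ [p]b` on `Ŵ(𝔫)`** (AEC IV.2.3). [cite: SilvermanAEC2009, IV.2.3] -/
theorem mulP_addW (a b : (nilTheta D hθ).toIdeal) : mulP W (addW W a b) = addW W (mulP W a) (mulP W b) := by
  rw [mulP, addW, evalPt₁_formalMul_evalPt W]
  rfl

omit [Fact (¬ IsUnit (p : integerC F))] [IsAdicComplete (Ideal.span {(p : integerC F)}) (integerC F)] in
/-- **`[p](s ⊕ s') = [p]s ⊕ [p]s'` on `Ŵ(𝔪_{ℂ_F})`** (AEC IV.2.3). [cite: SilvermanAEC2009, IV.2.3] -/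
theorem mulPC_addWC (s s' : (maxNilIdealC F).toIdeal) :
    mulPC W (addWC W s s') = addWC W (mulPC W s) (mulPC W s') := by
  rw [mulPC, addWC, evalPt₁_formalMul_evalPt W]
  rfl

/-- **`θ(a ⊕ b) = θ(a) ⊕ θ(b)`.** [cite: CasselsFrohlichANT1967, Ch. VI §3.2] -/
theorem theta_addW (a b : (nilTheta D hθ).toIdeal) :
    theta D (addW W a b : AinfRamTop D) =
      (addWC W ⟨theta D a, theta_mem_maxNilIdealC a.2⟩ ⟨theta D b, theta_mem_maxNilIdealC b.2⟩ : CBall F) :=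
  theta_evalPt (EisensteinRoot.theta_algebraMap_coeffDisc D) _
    W.constantCoeff_formalGroupLaw ![a, b]
    ![⟨theta D a, theta_mem_maxNilIdealC a.2⟩, ⟨theta D b, theta_mem_maxNilIdealC b.2⟩]
    fun i => by fin_cases i <;> rfl

/-- **Congruence-continuity of `⊕_W`**: `a ≡ a'`, `b ≡ b' (mod (p,ω)^{k+1})` ⇒ `a ⊕ b ≡ a' ⊕ b'`.
[cite: CasselsFrohlichANT1967, Ch. VI §3.2] -/
theorem addW_sub_addW_mem (k : ℕ) (a a' b b' : (nilTheta D hθ).toIdeal)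
    (ha : (a : AinfRamTop D) - a' ∈ (WithIdeal.i ^ (k + 1) : Ideal (AinfRamTop D)))
    (hb : (b : AinfRamTop D) - b' ∈ (WithIdeal.i ^ (k + 1) : Ideal (AinfRamTop D))) :
    (addW W a b : AinfRamTop D) - addW W a' b' ∈ (WithIdeal.i ^ (k + 1) : Ideal (AinfRamTop D)) :=
  evalPt_sub_evalPt_mem (isClosed_of_pow_le le_rfl) _ _ ![a, b] ![a', b'] fun i => by
    fin_cases i
    · exact ha
    · exact hb

/-! ## §3 Additivity of Fontaine's element -/

/-- The termwise sum `n ↦ tₙ ⊕_W t'ₙ` of two sequences of points of `Ŵ(𝔪_{ℂ_F})`. [cite: SilvermanAEC2009, IV.2.3] -/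
def addSeq (t t' : ℕ → (maxNilIdealC F).toIdeal) (n : ℕ) : (maxNilIdealC F).toIdeal := addWC W (t n) (t' n)

omit [Fact (¬ IsUnit (p : integerC F))] [IsAdicComplete (Ideal.span {(p : integerC F)}) (integerC F)] in
/-- The sum of two `[p]`-compatible sequences is `[p]`-compatible. [cite: SilvermanAEC2009, IV.2.3] -/
theorem mulPC_addSeq {t t' : ℕ → (maxNilIdealC F).toIdeal} (htp : ∀ n, mulPC W (t (n + 1)) = t n)
    (htp' : ∀ n, mulPC W (t' (n + 1)) = t' n) (n : ℕ) :
    mulPC W (addSeq W t t' (n + 1)) = addSeq W t t' n := by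
  rw [addSeq, addSeq, mulPC_addWC, htp, htp']

omit [Fact (¬ IsUnit (p : integerC F))] [IsAdicComplete (Ideal.span {(p : integerC F)}) (integerC F)] in
/-- `0 ⊕_W 0 = 0` on `Ŵ(𝔪_{ℂ_F})` (the law has no constant term). [cite: CasselsFrohlichANT1967, Ch. VI §3.2] -/
theorem coe_addSeq_zero {t t' : ℕ → (maxNilIdealC F).toIdeal} (ht0 : (t 0 : CBall F) = 0) (ht0' : (t' 0 : CBall F) = 0) :
    (addSeq W t t' 0 : CBall F) = 0 := by
  -- `F(0,0)` differs from `F(t₀, t'₀) - ` nothing: evaluate at the zero family via the congruence lemma style: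
  -- every monomial of positive degree vanishes at `0`, and the constant term is `0`.
  have hx : (fun i : Fin 2 => ((![t 0, t' 0] i : (maxNilIdealC F).toIdeal) : CBall F)) = fun _ => 0 := by
    funext i; fin_cases i
    · exact ht0
    · exact ht0'
  rw [addSeq, addWC, coe_evalPt]
  rw [aeval_congr_point ((maxNilIdealC F).hasEval ![t 0, t' 0]) (HasEval.zero) hx W.formalGroupLaw]
  have h := (hasSum_aeval (HasEval.zero (σ := Fin 2) (S := CBall F)) W.formalGroupLaw).tsum_eq
  rw [← h, tsum_eq_single 0]
  · simp [W.constantCoeff_formalGroupLaw]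
  · intro d hd
    obtain ⟨i, hi⟩ := Finsupp.ne_iff.mp hd
    rw [Finsupp.prod, ← Finset.prod_erase_mul _ _ (Finsupp.mem_support_iff.mpr hi)]
    simp [zero_pow hi]

/-- **Additivity of Fontaine's element: `[t ⊕ t'] = [t] ⊕_W [t']` in `Ŵ(𝔫)`.** For `[p]`-compatible torsion sequences
`t, t'` of `Ŵ(𝔪_{ℂ_F})`, Fontaine's element of the termwise formal-group sum is the formal-group sum, in
`𝔫_𝒪 ⊂ A_inf(𝒪)`, of the Fontaine elements. [cite: FontaineAsterisque223III, Exp. II §1.2.2] [cite: SilvermanAEC2009, IV.2.3] -/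
theorem torsionLift_addSeq {t t' : ℕ → (maxNilIdealC F).toIdeal} (htp : ∀ n, mulPC W (t (n + 1)) = t n)
    (htp' : ∀ n, mulPC W (t' (n + 1)) = t' n) :
    torsionLift W hθ (addSeq W t t') (mulPC_addSeq W htp htp') =
      (addW W ⟨torsionLift W hθ t htp, flim_mem_nilTheta _ _⟩ ⟨torsionLift W hθ t' htp', flim_mem_nilTheta _ _⟩ :
        AinfRamTop D) := by
  -- lifts of the sum sequence: the sums of the lifts
  have hlift : ∀ n, theta D (addW W (lift D hθ t n) (lift D hθ t' n) : AinfRamTop D) = addSeq W t t' n := fun n => by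
    have h1 : (⟨theta D (lift D hθ t n : AinfRamTop D), theta_mem_maxNilIdealC (lift D hθ t n).2⟩ : (maxNilIdealC F).toIdeal) =
        t n := Subtype.ext (theta_lift t n)
    have h2 : (⟨theta D (lift D hθ t' n : AinfRamTop D), theta_mem_maxNilIdealC (lift D hθ t' n).2⟩ : (maxNilIdealC F).toIdeal) =
        t' n := Subtype.ext (theta_lift t' n)
    rw [theta_addW, addSeq, h1, h2]
  rw [torsionLift_eq_flim W (mulPC_addSeq W htp htp') hlift]
  exact flim_op (isContracting_mulP (hθ := hθ) W) (fun k a a' b b' ha hb => addW_sub_addW_mem W k a a' b b' ha hb)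
    (mulP_addW W) (fun _ => rfl) _ _ _

end AinfRamTop

end Literature.NumberTheory.PAdicHodge

end
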